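/-
Copyright: statement-level skeleton of a published paper (lit-balaban cell, Phase-2 proof seat p13, gen 11). No proof
claims beyond what the kernel checks below.
-/
import Literature.MathematicalPhysics.QuantumFieldTheory.BalabanImbrieJaffe1984to88.BIJ88SmallChargeRegime

/-!
# `BalabanImbrieJaffe1984to88.BIJ88VolumeBeaten292` — T. Bałaban, J. Imbrie, A. Jaffe, *Effective action and cluster
properties of the abelian Higgs model*, Commun. Math. Phys. **114** (1988) 257–315 [BalabanImbrieJaffe1988]: Sect. 5.7,
p. 292 — THE VOLUME FACTOR OF THE `W^{(j)″}` TERMS IS BEATEN BY THE LARGE-FIELD FACTORS.  The print, verbatim (p. 292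
[PDF 36], after the bound *"|W^{(j)″}(X)| ≦ e_j^{1−α} e^{−cr(e_k)|X|} |X′ ∩ Λ₅^{(j)′} ∩ Λ₆^{(j+1)c}|"*):

*"Each term contributing to W^{(j)″}(X) must contain at least one kernel w₅. There is a summation in Λ₁₀^{(j)}, but since at
least one field Ã_j is present, there is an exponential decay on the j-th scale localizing summations near Λ₅^{(j)′} ∩
Λ₆^{(j+1)c}. This gives rise to the volume factor in the above bound. The volume divergence will be beaten by small factors
coming from large fields near Λ₅^{(j)′} ∩ Λ₆^{(j+1)c}; we will have available some e_j^{κ|Λ₅^{(j)′} ∩ Λ₆^{(j+1)c}|/r(e_j)^d}, and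
since κ(log e_j^{−1}) r(e_j)^{−d} > Σ_{k=j+1}^{log_L(ε₀/ε)} e_j^{1−α}, this is sufficient."*

This file kernel-checks the ARITHMETIC of the last sentence for the running charge (2.2) *"e_k = (L^kε)^{(4−d)/2}e"* (r18's
`BIJ88Sect2Statements.eK`) and the localization length (2.3) *"r(e_k) = |log e_k⁻¹|^r"* (`BIJ88Sect2Statements.rLen`):
the displayed inequality holds once `e_j` is small, and it is exactly what makes the available large-field factor dominate
the accumulated volume factors, `e_j^{κV/r(e_j)^d} · Π_{k=j+1}^{K} e^{e_j^{1−α}V} ≤ 1` for every volume `V ≥ 0`.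

statement-level skeleton of published theorems with citation tags; proofs where landed; nothing here is a claim about the Yang–Mills mass gap

PDF held: `paper:balaban1988-cmp114-bij-abelian-higgs-effective-action` (journal page = PDF page + 256); p. 292 [PDF 36]
read as IMAGE (CCITT render; copy `HOME/lit-balaban-p13/pages/original-p036-x2.png`), p. 260 [PDF 4] for (2.2)/(2.3).

CITATION HEADER (lean-in-tree rule).  Part of the lit-balaban TYPED SKELETON (HOME `run/shared/lean/pub/lit-balaban/`):
WHAT IS REPRODUCED = row **C2.Eq5.7.10-5.7.12** of `HOME/lit-balaban-r16/ROWS-C2-part2.md` (E-row, pp. 291–294), member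
*p. 292, the W″ volume sentence*.  Unit `lit-balaban-p13` (gen 11), owner r16, referee ref-5.  Built BY NAME on r18's
`eK`/`rLen`, p36's multiscale arithmetic `BIJ88ScaleSums` (`log_inv_scale`, `eK_scale_family`, `ratio_pos_lt_one`,
`log_inv_ratio`, `eK_pos`) and the `e → 0⁺` regime lemmas of `BIJ88SmallChargeRegime` (`eventually_rLen_pow_le_rpow_neg`,
`eventually_const_mul_rpow_le_one`, `exists_threshold`); nothing restated.

## What is kernel-checked here

* §1 THE NUMBER OF REMAINING SCALES — the upper limit *"log_L(ε₀/ε)"* of the printed sum: for charges scaling geometrically,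
  `e_j = e_K q^{K−j}` with `0 < q < 1` and `e_K ≤ 1` (the last scale), **`scales_le_log`**: `K − j ≤ log(e_j⁻¹)/log(q⁻¹)`; for
  (2.2), `q = L^{−(4−d)/2}`, **`scales_le_log_eK`**: `K − j ≤ (2/((4−d) log L))·log(e_j⁻¹)`; and the printed sum is
  `(K − j)·e_j^{1−α}` (`sum_Ioc_const_rpow`).
* §2 THE PRINTED INEQUALITY for `e_j → 0⁺`: **`eventually_ineq292`** — for `κ > 0`, `α < 1`, any `r`, `d` and any slope `A`, eventually in
  `x = e_j`: every `N` with `0 ≤ N ≤ A·log(x⁻¹)` has `N·x^{1−α} < κ·log(x⁻¹)·r(x)^{−d}` (mechanism: `r(x)^d ≤ x^{−(1−α)/2}`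
  eventually — powers of the localization length are below any inverse power of the charge — and `A x^{(1−α)/2} < κ`
  eventually); threshold form **`ineq292_threshold`**.
* §3 *"THIS IS SUFFICIENT"*: **`largeField_beats_volume`** — whenever `N·x^{1−α} ≤ κ·log(x⁻¹)·r(x)^{−d}`, for every `V ≥ 0`:
  `x^{κV/r(x)^d} · e^{N x^{1−α} V} ≤ 1` (the available factor `e_j^{κ|Λ₅′∩Λ₆ᶜ|/r(e_j)^d}` times the accumulated volume factors
  `Π_k e^{e_j^{1−α}|Λ₅′∩Λ₆ᶜ|}` is at most one); product form **`largeField_beats_volume_prod`**.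
* §4 THE INSTANCE OF RECORD on (2.2)/(2.3): **`ineq292_eK`** — for `L > 1`, `d < 4`, `ε, e > 0`, `κ > 0`, `α < 1` there is
  `δ > 0` such that for all scales `j ≤ K` with `e_K ≤ 1` and `e_j < δ`:
  `Σ_{k=j+1}^{K} e_j^{1−α} < κ·log(e_j⁻¹)·r(e_j)^{−d}` and, for every `V ≥ 0`,
  `e_j^{κV/r(e_j)^d} · Π_{k=j+1}^{K} e^{e_j^{1−α}V} ≤ 1`.

HONEST SCOPE.  Arithmetic of the printed sentence only: the volume `V = |Λ₅^{(j)′} ∩ Λ₆^{(j+1)c}|` is a free non-negative real,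
the availability of the large-field factor `e_j^{κV/r(e_j)^d}` (Sects. 5.2–5.5) and the per-scale accumulation of the W″
volume factors as `e^{e_j^{1−α}V}` (one factor per later scale `k = j+1, …, K`, the reading of the printed sum) are the
print's bookkeeping, taken as the shape of the statement, not derived; `K` = the last scale (`e_K ≤ 1`, print: `log_L(ε₀/ε)`;
any `K′ ≤ K` is covered since the sum only decreases).  The localization mechanism of the first sentences (the volume factor
|X′ ∩ Λ₅′ ∩ Λ₆ᶜ| itself) is NOT here.  Theorems only; no definitions, no `Prop` facts; axioms standard.
-/

noncomputable section

open scoped BigOperators Topology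
open Finset Filter

namespace Literature.MathematicalPhysics.QuantumFieldTheory.BalabanImbrieJaffe1984to88.BIJ88VolumeBeaten292

open BIJ88Sect2Statements (rLen eK)
open BIJ88ScaleSums BIJ88SmallChargeRegime

/-! ## §1 The number of remaining scales `K − j` (the upper limit `log_L(ε₀/ε)` of the printed sum) -/

section Scales

/-- **The number of remaining scales is logarithmic in the charge.**  For charges scaling geometrically across scales,
`e_j = e_K q^{K−j}` (`0 < q < 1`), with `0 < e_K ≤ 1` at the last scale `K`: `K − j ≤ log(e_j⁻¹)/log(q⁻¹)` for `j ≤ K` — since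
`log e_j⁻¹ = log e_K⁻¹ + (K − j) log q⁻¹` and `log e_K⁻¹ ≥ 0`. [cite: BalabanImbrieJaffe1988, (2.2) p.260, p.292] -/
theorem scales_le_log {e : ℕ → ℝ} {q : ℝ} {K : ℕ} (he : ∀ j, j ≤ K → e j = e K * q ^ (K - j)) (hq0 : 0 < q)
    (hq1 : q < 1) (heK : 0 < e K) (heK1 : e K ≤ 1) {j : ℕ} (hj : j ≤ K) :
    ((K - j : ℕ) : ℝ) ≤ Real.log (e j)⁻¹ / Real.log q⁻¹ := by
  have hlq : 0 < Real.log q⁻¹ := Real.log_pos ((one_lt_inv₀ hq0).mpr hq1)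
  rw [le_div_iff₀ hlq, log_inv_scale he hq0 heK hj]
  have h0 : 0 ≤ Real.log (e K)⁻¹ := Real.log_nonneg ((one_le_inv₀ heK).mpr heK1)
  linarith

variable {L ε e₀ : ℝ} {d : ℕ}

/-- **(2.2): `K − j ≤ (2/((4−d) log L))·log(e_j⁻¹)`** for `L > 1`, `d < 4`, `ε, e > 0`, `j ≤ K` and `e_K ≤ 1` (the ratio of
(2.2) is `q = L^{−(4−d)/2}`, `log q⁻¹ = ((4−d)/2) log L`) — the printed number of terms `log_L(ε₀/ε) − j` of the sum
`Σ_{k=j+1}^{log_L(ε₀/ε)} e_j^{1−α}` is `O(log e_j⁻¹)`. [cite: BalabanImbrieJaffe1988, (2.2) p.260, p.292] -/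
theorem scales_le_log_eK (hL : 1 < L) (hε : 0 < ε) (he₀ : 0 < e₀) (hd : d < 4) {j K : ℕ} (hj : j ≤ K)
    (heK1 : eK L ε e₀ d K ≤ 1) :
    ((K - j : ℕ) : ℝ) ≤ 2 / ((4 - (d : ℝ)) * Real.log L) * Real.log (eK L ε e₀ d j)⁻¹ := by
  obtain ⟨hq0, hq1⟩ := ratio_pos_lt_one hL hd
  have hL0 : 0 < L := by linarith
  have hd' : (d : ℝ) < 4 := by exact_mod_cast hd
  have hlogL : 0 < Real.log L := Real.log_pos hL
  have h := scales_le_log (eK_scale_family hL0 hε e₀ K) hq0 hq1 (eK_pos hL0 hε he₀ K) heK1 hj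
  rw [log_inv_ratio (d := d) hL0] at h
  refine h.trans (le_of_eq ?_)
  have h4 : (4 - (d : ℝ)) ≠ 0 := by linarith
  field_simp

/-- The printed sum has constant terms: `Σ_{k=j+1}^{K} x^{1−α} = (K − j)·x^{1−α}`.
[cite: BalabanImbrieJaffe1988, p.292] -/
theorem sum_Ioc_const_rpow (j K : ℕ) (x α : ℝ) :
    ∑ _k ∈ Finset.Ioc j K, x ^ (1 - α) = ((K - j : ℕ) : ℝ) * x ^ (1 - α) := by
  rw [Finset.sum_const, nsmul_eq_mul, Nat.card_Ioc]

end Scales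

/-! ## §2 The printed inequality `κ(log e_j⁻¹) r(e_j)^{−d} > Σ_{k=j+1}^{log_L(ε₀/ε)} e_j^{1−α}` for small `e_j` -/

section Inequality

/-- **THE PRINTED INEQUALITY, eventually in `x = e_j → 0⁺`.**  For `κ > 0`, `α < 1`, any exponent `r` of (2.3), any `d` and
any slope `A` of the scale count: eventually, every number of terms `N` with `0 ≤ N ≤ A·log(x⁻¹)` satisfies
`N·x^{1−α} < κ·log(x⁻¹)·r(x)^{−d}` — *"since κ(log e_j^{−1}) r(e_j)^{−d} > Σ_{k=j+1}^{log_L(ε₀/ε)} e_j^{1−α}"*.  Mechanism: `r(x)^d ≤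
x^{−(1−α)/2}` eventually (`BIJ88SmallChargeRegime.eventually_rLen_pow_le_rpow_neg`) and `A·x^{(1−α)/2} < κ` eventually.
[cite: BalabanImbrieJaffe1988, p.292] -/
theorem eventually_ineq292 (κ α r A : ℝ) (d : ℕ) (hκ : 0 < κ) (hα : α < 1) :
    ∀ᶠ x : ℝ in 𝓝[>] 0, ∀ N : ℝ, 0 ≤ N → N ≤ A * Real.log x⁻¹ →
      N * x ^ (1 - α) < κ * Real.log x⁻¹ * (rLen r x ^ d)⁻¹ := by
  have hs : 0 < (1 - α) / 2 := by linarith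
  filter_upwards [eventually_rLen_pow_le_rpow_neg r ((1 - α) / 2) d hs,
    eventually_const_mul_rpow_le_one (2 * (A + 1) / κ) ((1 - α) / 2) hs, Ioo_mem_nhdsGT one_pos] with x hr hAx hx01
  intro N hN0 hNA
  have hx : 0 < x := hx01.1
  have hlog : 0 < Real.log x⁻¹ := Real.log_pos ((one_lt_inv₀ hx).mpr hx01.2)
  have hxs : 0 < x ^ ((1 - α) / 2) := Real.rpow_pos_of_pos hx _
  -- r(x)^d > 0 and (r(x)^d)⁻¹ ≥ x^{(1−α)/2}
  have hrpos : 0 < rLen r x ^ d := by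
    have : 0 < rLen r x := by
      unfold rLen
      exact Real.rpow_pos_of_pos (abs_pos.mpr hlog.ne') _
    exact pow_pos this d
  have hinv : x ^ ((1 - α) / 2) ≤ (rLen r x ^ d)⁻¹ := by
    rw [le_inv_comm₀ hxs hrpos, ← Real.rpow_neg hx.le]
    exact hr
  -- A x^{(1−α)/2} < κ
  have hAκ : A * x ^ ((1 - α) / 2) < κ := by
    have h1 : 2 * (A + 1) / κ * x ^ ((1 - α) / 2) ≤ 1 := hAx
    rw [div_mul_eq_mul_div, div_le_one hκ] at h1
    nlinarith
  -- x^{1−α} = x^{(1−α)/2} · x^{(1−α)/2}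
  have hsplit : x ^ (1 - α) = x ^ ((1 - α) / 2) * x ^ ((1 - α) / 2) := by
    rw [← Real.rpow_add hx]; ring_nf
  calc N * x ^ (1 - α) ≤ A * Real.log x⁻¹ * x ^ (1 - α) :=
        mul_le_mul_of_nonneg_right hNA (Real.rpow_nonneg hx.le _)
    _ = Real.log x⁻¹ * (A * x ^ ((1 - α) / 2)) * x ^ ((1 - α) / 2) := by rw [hsplit]; ring
    _ < Real.log x⁻¹ * κ * x ^ ((1 - α) / 2) := by
        have : Real.log x⁻¹ * (A * x ^ ((1 - α) / 2)) < Real.log x⁻¹ * κ := mul_lt_mul_of_pos_left hAκ hlog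
        exact mul_lt_mul_of_pos_right this hxs
    _ ≤ Real.log x⁻¹ * κ * (rLen r x ^ d)⁻¹ :=
        mul_le_mul_of_nonneg_left hinv (mul_nonneg hlog.le hκ.le)
    _ = κ * Real.log x⁻¹ * (rLen r x ^ d)⁻¹ := by ring

/-- The printed inequality as an explicit threshold: there is `δ > 0` (depending on `κ, α, r, d, A` only) such that for
`0 < x < δ` every `N` with `0 ≤ N ≤ A·log(x⁻¹)` has `N·x^{1−α} < κ·log(x⁻¹)·r(x)^{−d}`. [cite: BalabanImbrieJaffe1988, p.292] -/
theorem ineq292_threshold (κ α r A : ℝ) (d : ℕ) (hκ : 0 < κ) (hα : α < 1) :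
    ∃ δ > 0, ∀ x, 0 < x → x < δ → ∀ N : ℝ, 0 ≤ N → N ≤ A * Real.log x⁻¹ →
      N * x ^ (1 - α) < κ * Real.log x⁻¹ * (rLen r x ^ d)⁻¹ :=
  exists_threshold (eventually_ineq292 κ α r A d hκ hα)

end Inequality

/-! ## §3 *"this is sufficient"*: the large-field factor dominates the accumulated volume factors -/

section Sufficient

/-- **"THIS IS SUFFICIENT".**  If `N·x^{1−α} ≤ κ·log(x⁻¹)·r(x)^{−d}` then for every volume `V ≥ 0` the available large-field factor
`x^{κV/r(x)^d}` (print: `e_j^{κ|Λ₅^{(j)′}∩Λ₆^{(j+1)c}|/r(e_j)^d}`) beats the accumulated volume factors `e^{N·x^{1−α}·V}`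
(print: one factor `e^{e_j^{1−α}|Λ₅′∩Λ₆ᶜ|}` per later scale): `x^{κV/r(x)^d} · e^{N x^{1−α} V} ≤ 1` — the exponent is
`V·(N x^{1−α} − κ log(x⁻¹) r(x)^{−d}) ≤ 0`. [cite: BalabanImbrieJaffe1988, p.292] -/
theorem largeField_beats_volume {x κ r α N V : ℝ} {d : ℕ} (hx : 0 < x) (hV : 0 ≤ V)
    (h : N * x ^ (1 - α) ≤ κ * Real.log x⁻¹ * (rLen r x ^ d)⁻¹) :
    x ^ (κ * V / rLen r x ^ d) * Real.exp (N * x ^ (1 - α) * V) ≤ 1 := by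
  have hpow : x ^ (κ * V / rLen r x ^ d) = Real.exp (-(κ * V / rLen r x ^ d * Real.log x⁻¹)) := by
    rw [Real.rpow_def_of_pos hx, Real.log_inv]; ring_nf
  rw [hpow, ← Real.exp_add, Real.exp_le_one_iff]
  have hV' : V * (N * x ^ (1 - α)) ≤ V * (κ * Real.log x⁻¹ * (rLen r x ^ d)⁻¹) := mul_le_mul_of_nonneg_left h hV
  have hrw : -(κ * V / rLen r x ^ d * Real.log x⁻¹) + N * x ^ (1 - α) * V =
      V * (N * x ^ (1 - α)) - V * (κ * Real.log x⁻¹ * (rLen r x ^ d)⁻¹) := by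
    rw [div_eq_mul_inv]; ring
  rw [hrw]
  linarith

/-- Product form over the later scales `k = j+1, …, K`: with `N = K − j`, if `Σ_{k=j+1}^{K} x^{1−α} ≤ κ·log(x⁻¹)·r(x)^{−d}` then
`x^{κV/r(x)^d} · Π_{k=j+1}^{K} e^{x^{1−α}V} ≤ 1` for every `V ≥ 0`. [cite: BalabanImbrieJaffe1988, p.292] -/
theorem largeField_beats_volume_prod {x κ r α V : ℝ} {d : ℕ} {j K : ℕ} (hx : 0 < x) (hV : 0 ≤ V)
    (h : ∑ _k ∈ Finset.Ioc j K, x ^ (1 - α) ≤ κ * Real.log x⁻¹ * (rLen r x ^ d)⁻¹) :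
    x ^ (κ * V / rLen r x ^ d) * ∏ _k ∈ Finset.Ioc j K, Real.exp (x ^ (1 - α) * V) ≤ 1 := by
  rw [sum_Ioc_const_rpow] at h
  rw [Finset.prod_const, Nat.card_Ioc, ← Real.exp_nat_mul, ← mul_assoc]
  exact largeField_beats_volume hx hV h

end Sufficient

/-! ## §4 The instance of record: (2.2) `e_k = (L^kε)^{(4−d)/2}e` and (2.3) `r(e) = |log e⁻¹|^r` -/

section Instance

variable {L ε e₀ : ℝ} {d : ℕ}

/-- **p. 292 FOR THE RUNNING CHARGE (2.2), `e ≪ 1`.**  For `L > 1`, `d < 4`, `ε, e > 0`, `κ > 0`, `α < 1` and any exponent `r`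
of (2.3) there is `δ > 0` such that at every scale `j ≤ K` (`K` the last scale, `e_K ≤ 1`) with `e_j < δ`:
the printed inequality *"κ(log e_j^{−1}) r(e_j)^{−d} > Σ_{k=j+1}^{log_L(ε₀/ε)} e_j^{1−α}"* holds, and consequently (*"this is
sufficient"*) for every volume `V ≥ 0` (print: `|Λ₅^{(j)′} ∩ Λ₆^{(j+1)c}|`) the available large-field factor dominates the
accumulated volume factors of the W″ terms: `e_j^{κV/r(e_j)^d} · Π_{k=j+1}^{K} e^{e_j^{1−α}V} ≤ 1`.
[cite: BalabanImbrieJaffe1988, p.292] -/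
theorem ineq292_eK (hL : 1 < L) (hε : 0 < ε) (he₀ : 0 < e₀) (hd : d < 4) {κ α : ℝ} (r : ℝ) (hκ : 0 < κ)
    (hα : α < 1) :
    ∃ δ > 0, ∀ j K : ℕ, j ≤ K → eK L ε e₀ d K ≤ 1 → eK L ε e₀ d j < δ →
      (∑ _k ∈ Finset.Ioc j K, eK L ε e₀ d j ^ (1 - α)
          < κ * Real.log (eK L ε e₀ d j)⁻¹ * (rLen r (eK L ε e₀ d j) ^ d)⁻¹) ∧
      ∀ V : ℝ, 0 ≤ V →
        eK L ε e₀ d j ^ (κ * V / rLen r (eK L ε e₀ d j) ^ d) *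
          ∏ _k ∈ Finset.Ioc j K, Real.exp (eK L ε e₀ d j ^ (1 - α) * V) ≤ 1 := by
  obtain ⟨δ, hδ, hineq⟩ := ineq292_threshold κ α r (2 / ((4 - (d : ℝ)) * Real.log L)) d hκ hα
  refine ⟨δ, hδ, fun j K hjK heK1 hej => ?_⟩
  have hL0 : 0 < L := by linarith
  have hej0 : 0 < eK L ε e₀ d j := eK_pos hL0 hε he₀ j
  have hsum : ∑ _k ∈ Finset.Ioc j K, eK L ε e₀ d j ^ (1 - α)
      < κ * Real.log (eK L ε e₀ d j)⁻¹ * (rLen r (eK L ε e₀ d j) ^ d)⁻¹ := by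
    rw [sum_Ioc_const_rpow]
    exact hineq _ hej0 hej _ (Nat.cast_nonneg _) (scales_le_log_eK hL hε he₀ hd hjK heK1)
  exact ⟨hsum, fun V hV => largeField_beats_volume_prod hej0 hV hsum.le⟩

end Instance

end Literature.MathematicalPhysics.QuantumFieldTheory.BalabanImbrieJaffe1984to88.BIJ88VolumeBeaten292
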